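import Literature.AlgebraicGeometry.Morphisms.ProjectiveOfFibrewiseVeryAmple
import Literature.AlgebraicGeometry.Morphisms.SectionsLiftOfFibreVanishingAtPrime
import Literature.AlgebraicGeometry.Motives.GeneratingSectionsSubfamilyEmbedding
import Literature.AlgebraicGeometry.Modules.PullbackFrame
import HarnessLib

/-!
# A fibre embedded by sections of `E|_{X₀}` with `H¹`-vanishing is the fibre of a projective neighbourhood

Topic `AlgebraicGeometry/Morphisms`; namespace `Literature.AlgebraicGeometry.Morphisms` (§3) after two bookkeeping
sections in `Literature.AlgebraicGeometry.Motives.GeneratingSections` (§1–§2). THEOREMS plus one re-indexing definition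
(`CocycleSections.precomp`); no named fact, no instance, no `sorry`.

**The statement (EGA III 4.7.1 with FIBRE-ONLY hypotheses; Hartshorne III 12.11 ⇒ II 7.x).** `f : X → Spec A` proper
and flat, `A` noetherian, `E` an `𝒪_X`-module with a rank-one frame system `F` (a line bundle with chosen local
generators), `𝔭 ∈ Spec A`, `X₀ = X ×_A κ(𝔭)` ANY cartesian square `HX`. Suppose

* `Ext¹_{𝒪_{X₀}}(𝒪_{X₀}, E|_{X₀}) = 0` (e.g. `H¹(X₀, E|_{X₀}) = 0`), and
* finitely many sections `s₀,…,sₙ ∈ Γ(X₀, E|_{X₀})` OF THE FIBRE generate `E|_{X₀}` and embed `X₀ ↪ ℙⁿ_{κ(𝔭)}`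
  (`IsClosedImmersion` of ★ `GeneratingSections.toProj` of ★ `CocycleSections.ofFrameSystem (F.pullback iX)`).

Then (`exists_isProjective_away_of_fibre_embedding`) for some `g ∉ 𝔭` and some `r ∉ 𝔭A_g`, the morphism
`X_g ×_{A_g} (A_g)_r → Spec (A_g)_r` is PROJECTIVE (★ `IsProjective`). Road: ★ G5
`span_unitSectionLE_top_eq_top_at_prime` (Mumford §5 Cor. 3 at a prime) says the restrictions `η(t)` of the global sections
`t ∈ Γ(X, E)` span `Γ(X₀, E|_{X₀})` over `κ(𝔭)`, so each `sᵢ` is a `κ(𝔭)`-combination of finitely many `η(t_j)`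
(`exists_fin_comb`, §3); by brick 1 ★ `isClosedImmersion_toProj_of_linear` («the `s` embed and are combinations of the `η(t)`
⇒ the `η(t)` embed») the restricted global sections embed the fibre; §1–§2 identify the fibre datum of the `η(t_j)` in the
pulled-back frames with the pulled-back datum ★ `(ofFrameSystem F h1 t).comap iX` that ★
`exists_isProjective_away_of_frameSystem` (EGA III 4.7.1 + H-projectivity, B-p20 (g10)) consumes.

* §1 `CocycleSections.precomp` — re-indexing the trivialising family along `φ : β → α`, and `ofCocycleSections_precomp`: the
  generating-sections datum (hence `toProj`) is unchanged when the `W (φ b)` still cover.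
* §2 `coeffAt_pullback` — **the coefficient of `η(t)` in the pulled-back generator is the pulled-back coefficient**
  (★ `Modules/PullbackFrame.basisSection_pullbackFrame`); `ofFrameSystem_pullback_eq_precomp_comap`; `coeffAt_sum_smul`
  (linearity of coefficients).
* §3 the head, with the intermediate `exists_globalSections_embedding_fibre` (∃ global `t : Fin (m+1) → Γ(X, E)` generating
  along `f⁻¹(𝔭)` whose restrictions embed `X₀`).

Cell `hodgecm-mathlib`, F-DAG (h2) F-2a «fibre-only hypotheses» brick 2 (B-p20 (g11)); count-neutral (HC_CM is proved only
modulo the 7 printed citations until rung 0 closes).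

## References
* A. Grothendieck, J. Dieudonné, *EGA III₁* (Publ. Math. IHÉS 11, 1961), Thm. 4.7.1. [EGAIII1]
* D. Mumford, *Abelian Varieties* (1970), §5 Cor. 3 (p. 53). [MumfordAV1970]
* R. Hartshorne, *Algebraic Geometry* (1977), II Thm. 7.1 and its proof, II Prop. 7.2, III Thm. 12.11. [Hartshorne1977]
-/

universe v w u

open CategoryTheory CategoryTheory.Limits CategoryTheory.Abelian AlgebraicGeometry TopologicalSpace Opposite
open Literature.AlgebraicGeometry.Modules

attribute [local instance] MvPolynomial.gradedAlgebra

-- `TopCat.Presheaf`/`Scheme.Modules` bookkeeping (as in ★ `Motives/GeneratingSectionsOfLineBundle`).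
set_option backward.isDefEq.respectTransparency false

noncomputable section

namespace Literature.AlgebraicGeometry.Motives

namespace GeneratingSections

/-! ## §1 Re-indexing the trivialising family of coefficient data -/

namespace CocycleSections

variable {ι : Type} {α : Type v} {β : Type w} {X : Scheme.{u}} {W : α → X.Opens}
  (S : CocycleSections ι W) (φ : β → α)

/-- **Re-indexed trivialisations**: the same sections, with coefficients read only in the trivialisations `W (φ b)`.
[cite: Hartshorne1977, II proof of Thm. 7.1] -/
def precomp : CocycleSections ι (fun b => W (φ b)) where
  coeff i b := S.coeff i (φ b)
  cross i j a b := S.cross i j (φ a) (φ b)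
  locus i a b := S.locus i (φ a) (φ b)

/-- The coefficients of the re-indexed datum (`rfl`). [cite: Hartshorne1977, II proof of Thm. 7.1] -/
@[simp] theorem precomp_coeff (i : ι) (b : β) : (S.precomp φ).coeff i b = S.coeff i (φ b) := rfl

/-- If the `W (φ b)` cover `X`, the non-vanishing locus `X_{t_i}` is already the union of the `X_{c i (φ b)}` (locus
compatibility). [cite: Hartshorne1977, II proof of Thm. 7.1] -/
theorem iSup_basicOpen_precomp_coeff (hW : ⨆ b, W (φ b) = ⊤) (i : ι) :
    ⨆ b, X.basicOpen ((S.precomp φ).coeff i b) = ⨆ a, X.basicOpen (S.coeff i a) := by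
  apply le_antisymm
  · exact iSup_le fun b ↦ le_iSup (fun a ↦ X.basicOpen (S.coeff i a)) (φ b)
  · refine iSup_le fun a x hx ↦ ?_
    have hxW : x ∈ (⨆ b, W (φ b)) := by rw [hW]; trivial
    obtain ⟨b, hb⟩ := Opens.mem_iSup.mp hxW
    exact Opens.mem_iSup.mpr ⟨b, S.locus i a (φ b) ⟨hx, hb⟩⟩

/-- If the `W (φ b)` cover `X` and the sections generate, they generate in the re-indexed trivialisations.
[cite: Hartshorne1977, II Thm. 7.1] -/
theorem iSup_basicOpen_precomp_coeff_eq_top (hW : ⨆ b, W (φ b) = ⊤)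
    (hcov : ⨆ i, ⨆ a, X.basicOpen (S.coeff i a) = ⊤) :
    ⨆ i, ⨆ b, X.basicOpen ((S.precomp φ).coeff i b) = ⊤ := by
  simp_rw [S.iSup_basicOpen_precomp_coeff φ hW]
  exact hcov

omit S φ in
/-- Two-step restriction of `𝒪_X` equals the one-step restriction with the same ends. [folklore] -/
private theorem map_map_eq {A B B' : X.Opens} (p : op A ⟶ op B) (q : op B ⟶ op B') (r : op A ⟶ op B')
    (x : Γ(X, A)) : X.presheaf.map q (X.presheaf.map p x) = X.presheaf.map r x := by
  rw [← CommRingCat.comp_apply, ← Functor.map_comp]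
  have : p ≫ q = r := congrArg Quiver.Hom.op (Subsingleton.elim (p ≫ q).unop r.unop)
  rw [this]

/-- **Re-indexing the trivialisations does not change the generating-sections datum** (same opens `X_{t_i}` by locus
compatibility, same ratios by their uniqueness ★ `ofCocycleSections_ratio_unique`); in particular the morphism `toProj`
to projective space is the same. [cite: Hartshorne1977, II Thm. 7.1] -/
theorem ofCocycleSections_precomp (hW : ⨆ b, W (φ b) = ⊤)
    (hcov : ⨆ i, ⨆ b, X.basicOpen ((S.precomp φ).coeff i b) = ⊤)
    (hcov' : ⨆ i, ⨆ a, X.basicOpen (S.coeff i a) = ⊤) :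
    ofCocycleSections (fun b => W (φ b)) (S.precomp φ) hcov = ofCocycleSections W S hcov' := by
  refine eq_of_U_eq (fun i ↦ S.iSup_basicOpen_precomp_coeff φ hW i) fun i j ↦ ?_
  symm
  refine ofCocycleSections_ratio_unique _ (S.precomp φ) hcov i j _ fun b ↦ ?_
  refine Eq.trans ?_ (ofCocycleSections_ratio_res_mul W S hcov' i j (φ b))
  congr 1
  exact map_map_eq _ _ _ _

end CocycleSections

/-! ## §2 Coefficients in pulled-back frames -/

section PullbackFrame

variable {X X' : Scheme.{u}} (g : X' ⟶ X) {E : X.Modules} (F : FrameSystem E) (h1 : ∀ x, F.rank x = 1)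
  {ι : Type} (t : ι → Γ(E, ⊤))

/-- Two-step restriction of an `𝒪_X`-module equals the one-step restriction with the same ends. [folklore] -/
private theorem mod_map_map_eq {Y : Scheme.{u}} (M : Y.Modules) {A B B' : Y.Opens} (p : op A ⟶ op B)
    (q : op B ⟶ op B') (r : op A ⟶ op B') (x : Γ(M, A)) :
    M.presheaf.map q (M.presheaf.map p x) = M.presheaf.map r x := by
  rw [← CategoryTheory.comp_apply, ← Functor.map_comp]
  have : p ≫ q = r := congrArg Quiver.Hom.op (Subsingleton.elim (p ≫ q).unop r.unop)
  rw [this]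

/-- **Linearity of the coefficients**: the coefficient at `x` of `∑_j r_j · u_j` is `∑_j r_j|_{U_x} · coeffAt u j x`
(coordinates in a frame are `𝒪_X`-linear). [cite: Hartshorne1977, II proof of Thm. 7.1] -/
theorem coeffAt_sum_smul {κ : Type} (T : Finset κ) (r : κ → Γ(X, ⊤)) (u : κ → Γ(E, ⊤)) {ι₀ : Type}
    (s : ι₀ → Γ(E, ⊤)) (i : ι₀) (hs : s i = ∑ j ∈ T, r j • u j) (x : X) :
    coeffAt F h1 s i x = ∑ j ∈ T, X.presheaf.map (homOfLE (le_top : F.U x ≤ ⊤)).op (r j) * coeffAt F h1 u j x := by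
  unfold coeffAt
  rw [hs, map_sum, coord_sum]
  refine Finset.sum_congr rfl fun j _ ↦ ?_
  rw [Scheme.Modules.map_smul, coord_smul]

/-- **The coefficient of the pulled-back section `η(t_i)` in the pulled-back generator at `x` is the pulled-back
coefficient** `g^♯(coeffAt t i (g x))` (the pulled-back frame has basis `η(b)`, ★ `basisSection_pullbackFrame`, and
`η(c · b) = g^♯(c) · η(b)`). [cite: Hartshorne1977, II.5 (p. 110)] -/
theorem coeffAt_pullback (h1' : ∀ x, (F.pullback g).rank x = 1) (i : ι) (x : X') :
    coeffAt (F.pullback g) h1' (fun i => unitSectionLE g E (V := ⊤) (U := ⊤) le_top (t i)) i x =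
      g.app (F.U (g.base x)) (coeffAt F h1 t i (g.base x)) := by
  classical
  letI : Fintype (F.I (g.base x)) := Fintype.ofEquiv _ (F.enum (g.base x)).symm
  -- the basis section of the pulled-back frame at `x` is `η(b_{g x})`
  have hb : basisSection (E := (Scheme.Modules.pullback g).obj E) ((F.pullback g).frame x) (F.idx h1 (g.base x)) =
      unitSection g E (F.U (g.base x)) (basisSection (F.frame (g.base x)) (F.idx h1 (g.base x))) :=
    basisSection_pullbackFrame g (F.frame (g.base x)) _
  -- the coefficient, read over the trivialising open of the pulled-back frame system
  let c' : Γ(X', (F.pullback g).U x) := g.app (F.U (g.base x)) (coeffAt F h1 t i (g.base x))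
  -- the restriction of `η(t_i)` to `g⁻¹ U_{g x}` is `η(t_i|_{U_{g x}}) = g^♯(c) · η(b)`
  have hres : ((Scheme.Modules.pullback g).obj E).presheaf.map
        (homOfLE (le_top : (F.pullback g).U x ≤ ⊤)).op (unitSectionLE g E (V := ⊤) (U := ⊤) le_top (t i)) =
      c' • basisSection (E := (Scheme.Modules.pullback g).obj E) ((F.pullback g).frame x) (F.idx h1 (g.base x)) := by
    calc ((Scheme.Modules.pullback g).obj E).presheaf.map (homOfLE (le_top : (F.pullback g).U x ≤ ⊤)).op
          (unitSectionLE g E (V := ⊤) (U := ⊤) le_top (t i))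
        = ((Scheme.Modules.pullback g).obj E).presheaf.map
            ((Opens.map g.base).map (homOfLE (le_top : F.U (g.base x) ≤ ⊤))).op (unitSection g E ⊤ (t i)) :=
          mod_map_map_eq _ _ _ _ _
      _ = unitSection g E (F.U (g.base x)) (E.presheaf.map (homOfLE (le_top : F.U (g.base x) ≤ ⊤)).op (t i)) :=
          (unitSection_map g E _ (t i)).symm
      _ = unitSection g E (F.U (g.base x)) (coeffAt F h1 t i (g.base x) •
            basisSection (F.frame (g.base x)) (F.idx h1 (g.base x))) := by
          rw [map_top_eq_coeffAt_smul F h1 t i (g.base x), op_id]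
          erw [CategoryTheory.Functor.map_id]
          rfl
      _ = g.app (F.U (g.base x)) (coeffAt F h1 t i (g.base x)) •
            unitSection g E (F.U (g.base x)) (basisSection (F.frame (g.base x)) (F.idx h1 (g.base x))) :=
          unitSection_smul g E _ _ _
      _ = c' • basisSection (E := (Scheme.Modules.pullback g).obj E) ((F.pullback g).frame x) (F.idx h1 (g.base x)) := by
          rw [hb]
  unfold coeffAt
  rw [hres, coord_smul, coord_basisSection, if_pos ((F.pullback g).eq_idx h1' x _), mul_one]
  rfl

/-- **The fibre datum of the pulled-back sections in the pulled-back frames is the pulled-back datum, re-indexed by the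
points of `X'`** (`x ↦ g x`): `ofFrameSystem (F.pullback g) (η ∘ t) = ((ofFrameSystem F t).comap g).precomp g`.
[cite: Hartshorne1977, II Thm. 7.1] -/
theorem ofFrameSystem_pullback_eq_precomp_comap (h1' : ∀ x, (F.pullback g).rank x = 1) :
    CocycleSections.ofFrameSystem (F.pullback g) h1' (fun i => unitSectionLE g E (V := ⊤) (U := ⊤) le_top (t i)) =
      ((CocycleSections.ofFrameSystem F h1 t).comap g).precomp g.base := by
  refine CocycleSections.ext (funext fun i ↦ funext fun x ↦ ?_)
  rw [CocycleSections.ofFrameSystem_coeff, coeffAt_pullback g F h1 t h1' i x]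
  rfl

/-- The trivialising opens `g⁻¹ U_{g x}` of the pulled-back frame system cover `X'`. [folklore] -/
private theorem iSup_pullback_U_eq_top : ⨆ x : X', (F.pullback g).U x = ⊤ :=
  top_le_iff.mp fun x _ ↦ Opens.mem_iSup.mpr ⟨x, (F.pullback g).mem x⟩

/-- **The morphism to `ℙ^ι` of the pulled-back sections in the pulled-back frames IS the morphism of the pulled-back
datum** (§1 re-indexing + `coeffAt_pullback`): the two generating-sections data on `X'` coincide.
[cite: Hartshorne1977, II Thm. 7.1] -/
theorem ofCocycleSections_ofFrameSystem_pullback (h1' : ∀ x, (F.pullback g).rank x = 1)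
    (hcov : ⨆ i, ⨆ x, X'.basicOpen ((CocycleSections.ofFrameSystem (F.pullback g) h1'
      (fun i => unitSectionLE g E (V := ⊤) (U := ⊤) le_top (t i))).coeff i x) = ⊤)
    (hcov₀ : ⨆ i, ⨆ a, X'.basicOpen (((CocycleSections.ofFrameSystem F h1 t).comap g).coeff i a) = ⊤) :
    ofCocycleSections (F.pullback g).U (CocycleSections.ofFrameSystem (F.pullback g) h1'
        (fun i => unitSectionLE g E (V := ⊤) (U := ⊤) le_top (t i))) hcov =
      ofCocycleSections (fun a => g ⁻¹ᵁ F.U a) ((CocycleSections.ofFrameSystem F h1 t).comap g) hcov₀ := by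
  have hcov' : ⨆ i, ⨆ x, X'.basicOpen ((((CocycleSections.ofFrameSystem F h1 t).comap g).precomp g.base).coeff i x) = ⊤ := by
    rw [← ofFrameSystem_pullback_eq_precomp_comap g F h1 t h1']
    exact hcov
  have key := ((CocycleSections.ofFrameSystem F h1 t).comap g).ofCocycleSections_precomp g.base
    (iSup_pullback_U_eq_top g F) hcov' hcov₀
  rw [← key]
  congr 1
  exact ofFrameSystem_pullback_eq_precomp_comap g F h1 t h1'

/-- Generation in the pulled-back frames ⇒ generation of the pulled-back datum (the `hcov₀` input of ★
`exists_isProjective_away_of_frameSystem`). [cite: Hartshorne1977, II Thm. 7.1] -/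
theorem iSup_basicOpen_comap_coeff_eq_top_of_pullback (h1' : ∀ x, (F.pullback g).rank x = 1)
    (hcov : ⨆ i, ⨆ x, X'.basicOpen ((CocycleSections.ofFrameSystem (F.pullback g) h1'
      (fun i => unitSectionLE g E (V := ⊤) (U := ⊤) le_top (t i))).coeff i x) = ⊤) :
    ⨆ i, ⨆ a, X'.basicOpen (((CocycleSections.ofFrameSystem F h1 t).comap g).coeff i a) = ⊤ := by
  rw [ofFrameSystem_pullback_eq_precomp_comap g F h1 t h1'] at hcov
  refine top_le_iff.mp (hcov.ge.trans (iSup_le fun i ↦ iSup_le fun x ↦ ?_))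
  exact (le_iSup (fun a ↦ X'.basicOpen (((CocycleSections.ofFrameSystem F h1 t).comap g).coeff i a)) (g.base x)).trans
    (le_iSup (fun i ↦ ⨆ a, X'.basicOpen (((CocycleSections.ofFrameSystem F h1 t).comap g).coeff i a)) i)

/-- Generation in the pulled-back frames at a point `x` of `X'` ⇒ `t_i` generates at `g x` (the `hgen` input of ★
`exists_isProjective_away_of_frameSystem`, pointwise). [cite: Hartshorne1977, II Thm. 7.1] -/
theorem mem_basicOpen_coeffAt_of_pullback (h1' : ∀ x, (F.pullback g).rank x = 1) (i : ι) (x : X')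
    (hx : x ∈ X'.basicOpen (coeffAt (F.pullback g) h1'
      (fun i => unitSectionLE g E (V := ⊤) (U := ⊤) le_top (t i)) i x)) :
    g.base x ∈ X.basicOpen (coeffAt F h1 t i (g.base x)) := by
  rw [coeffAt_pullback g F h1 t h1' i x, ← Scheme.preimage_basicOpen] at hx
  exact hx

end PullbackFrame

end GeneratingSections

end Literature.AlgebraicGeometry.Motives

namespace Literature.AlgebraicGeometry.Morphisms

open Literature.AlgebraicGeometry.Motives Literature.AlgebraicGeometry.Motives.GeneratingSections
open Literature.AlgebraicGeometry.Motives.Segre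

/-! ## §3 Fibre embedded by fibre sections + `H¹ = 0` ⇒ projective neighbourhood -/

/-- Two-step restriction of `𝒪_X` equals the one-step restriction with the same ends. [folklore] -/
private theorem mod_map_map_eq' (Y : Scheme.{u}) {A B B' : Y.Opens} (p : op A ⟶ op B) (q : op B ⟶ op B')
    (r : op A ⟶ op B') (x : Γ(Y, A)) : Y.presheaf.map q (Y.presheaf.map p x) = Y.presheaf.map r x := by
  rw [← CommRingCat.comp_apply, ← Functor.map_comp]
  have : p ≫ q = r := congrArg Quiver.Hom.op (Subsingleton.elim (p ≫ q).unop r.unop)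
  rw [this]

/-- **Finitely many elements of a module spanned by a family are combinations of ONE finite sub-family, `Fin`-indexed**
(bookkeeping: union of the supports, padded by a default index). [folklore] -/
private theorem exists_fin_comb {R M J : Type*} [Semiring R] [AddCommMonoid M] [Module R M] [Inhabited J]
    (η : J → M) (hη : Submodule.span R (Set.range η) = ⊤) {n : ℕ} (s : Fin (n + 1) → M) :
    ∃ (m : ℕ) (τ : Fin (m + 1) → J) (c : Fin (n + 1) → Fin (m + 1) → R), ∀ i, s i = ∑ j, c i j • η (τ j) := by
  classical
  have hmem : ∀ i, ∃ ci : J →₀ R, (ci.sum fun j a => a • η j) = s i := fun i ↦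
    Finsupp.mem_span_range_iff_exists_finsupp.mp (by rw [hη]; exact Submodule.mem_top)
  choose ci hci using hmem
  let T : Finset J := Finset.univ.biUnion fun i ↦ (ci i).support
  have hT : ∀ i, (ci i).support ⊆ T := fun i ↦ Finset.subset_biUnion_of_mem (fun i ↦ (ci i).support) (Finset.mem_univ i)
  let e : T ≃ Fin T.card := T.equivFin
  refine ⟨T.card, Fin.snoc (fun j ↦ (e.symm j : J)) default, fun i ↦ Fin.snoc (fun j ↦ ci i (e.symm j)) 0, fun i ↦ ?_⟩
  rw [Fin.sum_univ_castSucc]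
  simp only [Fin.snoc_castSucc, Fin.snoc_last, zero_smul, add_zero]
  rw [e.symm.sum_comp (fun u : T ↦ ci i u • η u), Finset.sum_coe_sort T (fun u ↦ ci i u • η u), ← hci i]
  exact Finsupp.sum_of_support_subset (ci i) (hT i) (fun j a ↦ a • η j) fun j _ ↦ by rw [zero_smul]

/-- In a cartesian square `fst ≫ f = snd ≫ g`, a point `x` with `f x = g y` is hit by `fst` (Mathlib
`Scheme.Pullback.exists_preimage_pullback`, transported along `IsPullback.isoPullback`). [folklore] -/
private theorem exists_eq_fst_of_isPullback {P X' Y Z : Scheme.{u}} {fst : P ⟶ X'} {snd : P ⟶ Y} {f : X' ⟶ Z}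
    {g : Y ⟶ Z} (h : IsPullback fst snd f g) (x : X') (y : Y) (hxy : f x = g y) : ∃ p : P, fst p = x := by
  haveI : HasPullback f g := h.hasPullback
  obtain ⟨z, hz, -⟩ := Scheme.Pullback.exists_preimage_pullback x y hxy
  refine ⟨h.isoPullback.inv z, ?_⟩
  rw [← Scheme.Hom.comp_apply, IsPullback.isoPullback_inv_fst, hz]

section FibreEmbedding

variable {A : Type} [CommRing A] [IsNoetherianRing A] {n : ℕ} {X : Scheme.{0}} (f : X ⟶ Spec (.of A))
  [IsProper f] [Flat f] (𝔭 : PrimeSpectrum A)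
  {X₀ : Scheme.{0}} {iX : X₀ ⟶ X} {f₀ : X₀ ⟶ Spec (.of 𝔭.asIdeal.ResidueField)}
  (HX : IsPullback iX f₀ f (Spec.map (CommRingCat.ofHom (algebraMap A 𝔭.asIdeal.ResidueField))))
  {E : X.Modules} (F : FrameSystem E) (h1 : ∀ x, F.rank x = 1)
  (hvan : Subsingleton (Ext.{1} (unitModule X₀) ((Scheme.Modules.pullback iX).obj E) 1))
  (h1₀ : ∀ x, (F.pullback iX).rank x = 1)
  (s : Fin (n + 1) → Γ((Scheme.Modules.pullback iX).obj E, ⊤))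
  (hcov : ⨆ i, ⨆ x, X₀.basicOpen ((CocycleSections.ofFrameSystem (F.pullback iX) h1₀ s).coeff i x) = ⊤)
  (H : IsClosedImmersion ((ofCocycleSections (F.pullback iX).U
    (CocycleSections.ofFrameSystem (F.pullback iX) h1₀ s) hcov).toProj f₀))

include HX hvan H

/-- **Fibre sections embedding the fibre are replaced by restricted GLOBAL sections** (EGA III 4.7.1, first half, with
fibre-only hypotheses): under `Ext¹(𝒪_{X₀}, E|_{X₀}) = 0`, if fibre sections `s₀,…,sₙ` of `E|_{X₀}` generate it and embed
`X₀ ↪ ℙⁿ_{κ(𝔭)}`, then there are global sections `t₀,…,t_m ∈ Γ(X, E)` generating `E` along `f⁻¹(𝔭)` whose restrictions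
`η(t_j)` generate `E|_{X₀}` and embed `X₀ ↪ ℙ^m_{κ(𝔭)}` — in the pulled-back-datum form ★ `exists_isProjective_away_of_frameSystem`
consumes. (★ G5 `span_unitSectionLE_top_eq_top_at_prime`: the `sᵢ` are `κ(𝔭)`-combinations of restricted global sections;
★ `isClosedImmersion_toProj_of_linear`: then the restricted global sections embed.)
[cite: EGAIII1, Thm. 4.7.1] [cite: MumfordAV1970, §5 Cor. 3 (p. 53)] -/
theorem exists_globalSections_embedding_fibre :
    ∃ (m : ℕ) (t : Fin (m + 1) → Γ(E, ⊤)),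
      (∀ x : X, f x = 𝔭 → ∃ j, x ∈ X.basicOpen (coeffAt F h1 t j x)) ∧
      ∃ hcov₀ : ⨆ j, ⨆ a, X₀.basicOpen (((CocycleSections.ofFrameSystem F h1 t).comap iX).coeff j a) = ⊤,
        IsClosedImmersion
          ((ofCocycleSections (fun a => iX ⁻¹ᵁ F.U a) ((CocycleSections.ofFrameSystem F h1 t).comap iX) hcov₀).toProj f₀) := by
  classical
  -- Step 0: notation and instances
  haveI : IsProper f₀ := MorphismProperty.of_isPullback HX inferInstance
  let E₀ : X₀.Modules := (Scheme.Modules.pullback iX).obj E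
  let F₀ : FrameSystem E₀ := F.pullback iX
  let η : Γ(E, ⊤) → Γ(E₀, ⊤) := fun u ↦ unitSectionLE iX E (V := ⊤) (U := ⊤) le_top u
  -- Step 1 (★ G5): the restricted global sections span the fibre sections over `κ(𝔭)`
  have hspan := span_unitSectionLE_top_eq_top_at_prime f E F.isFiniteLocallyFree 𝔭.asIdeal HX hvan
  -- Step 2: each `s i` is a `κ(𝔭)`-combination of finitely many `η(t_j)`, `t : Fin (m+1) → Γ(X, E)`
  letI : Inhabited (SecMod E f.appTop.hom ⊤) := ⟨SecMod.mk 0⟩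
  obtain ⟨m, τ, c, hc⟩ := exists_fin_comb _ hspan (fun i ↦ SecMod.mk (ρ := f₀.appTop.hom) (s i))
  let t : Fin (m + 1) → Γ(E, ⊤) := fun j ↦ SecMod.val (L := E) (ρ := f.appTop.hom) (τ j)
  -- the relation in `Γ(X₀, E|X₀)`: `s i = ∑ j, (f₀♯ c_{ij})|_⊤ • η(t j)`
  have hrel : ∀ i, s i = ∑ j, toSections f₀.appTop.hom ⊤ (c i j) • η (t j) := fun i ↦ by
    have h := congrArg (SecMod.val (L := E₀) (ρ := f₀.appTop.hom)) (hc i)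
    rw [SecMod.val_mk] at h
    rw [h]
    induction (Finset.univ : Finset (Fin (m + 1))) using Finset.induction_on with
    | empty => rfl
    | insert j T hj ih => rw [Finset.sum_insert hj, Finset.sum_insert hj, SecMod.val_add, ih]; rfl
  -- Step 3: the joint datum `(s, η ∘ t)` in the pulled-back frames and its linear relation over `κ(𝔭)`
  let u : Fin (n + 1) ⊕ Fin (m + 1) → Γ(E₀, ⊤) := Sum.elim s (fun j ↦ η (t j))
  let S : CocycleSections (Fin (n + 1) ⊕ Fin (m + 1)) F₀.U := CocycleSections.ofFrameSystem F₀ h1₀ u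
  let cc : Fin (n + 1) → Fin (m + 1) → 𝔭.asIdeal.ResidueField :=
    fun i j ↦ (Scheme.ΓSpecIso (.of 𝔭.asIdeal.ResidueField)).hom (c i j)
  have hpull : ∀ i j, pull f₀ (cc i j) = f₀.appTop (c i j) := fun i j ↦ by
    rw [pull_apply]
    change f₀.appTop (((Scheme.ΓSpecIso (.of 𝔭.asIdeal.ResidueField)).hom ≫
      (Scheme.ΓSpecIso (.of 𝔭.asIdeal.ResidueField)).inv) (c i j)) = _
    rw [Iso.hom_inv_id]
    rfl
  have hlin : ∀ i x, S.coeff (.inl i) x =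
      ∑ j, X₀.presheaf.map (homOfLE (le_top : F₀.U x ≤ ⊤)).op (pull f₀ (cc i j)) * S.coeff (.inr j) x := by
    intro i x
    change coeffAt F₀ h1₀ u (.inl i) x = ∑ j, _ * coeffAt F₀ h1₀ u (.inr j) x
    have hu : u (.inl i) = ∑ j ∈ Finset.univ, toSections f₀.appTop.hom ⊤ (c i j) • u (.inr j) := hrel i
    rw [coeffAt_sum_smul F₀ h1₀ Finset.univ (fun j ↦ toSections f₀.appTop.hom ⊤ (c i j)) (fun j ↦ u (.inr j)) u
      (.inl i) hu x]
    refine Finset.sum_congr rfl fun j _ ↦ ?_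
    congr 1
    rw [hpull, toSections, RingHom.comp_apply]
    exact mod_map_map_eq' X₀ _ _ _ _
  -- the two sub-families
  have hinl : S.restrict Sum.inl = CocycleSections.ofFrameSystem F₀ h1₀ s := CocycleSections.ext rfl
  have hinr : S.restrict Sum.inr = CocycleSections.ofFrameSystem F₀ h1₀ (fun j ↦ η (t j)) := CocycleSections.ext rfl
  have hcov_inl : ⨆ i, ⨆ x, X₀.basicOpen ((S.restrict Sum.inl).coeff i x) = ⊤ := by rw [hinl]; exact hcov
  have hcov_inr : ⨆ j, ⨆ x, X₀.basicOpen ((S.restrict Sum.inr).coeff j x) = ⊤ :=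
    iSup_basicOpen_inr_eq_top_of_linear f₀ S cc hlin hcov_inl
  have H' : IsClosedImmersion ((ofCocycleSections F₀.U (S.restrict Sum.inl) hcov_inl).toProj f₀) := by
    have e : ofCocycleSections F₀.U (S.restrict Sum.inl) hcov_inl =
        ofCocycleSections F₀.U (CocycleSections.ofFrameSystem F₀ h1₀ s) hcov := by
      congr 1
    rw [e]
    exact H
  -- Step 4 (brick 1): the restricted global sections `η(t_j)` embed the fibre
  have Ht : IsClosedImmersion ((ofCocycleSections F₀.U (S.restrict Sum.inr) hcov_inr).toProj f₀) :=
    isClosedImmersion_toProj_of_linear f₀ S cc hlin hcov_inl hcov_inr H'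
  have hcov_t : ⨆ j, ⨆ x, X₀.basicOpen ((CocycleSections.ofFrameSystem F₀ h1₀ (fun j ↦ η (t j))).coeff j x) = ⊤ := by
    rw [← hinr]; exact hcov_inr
  have Ht' : IsClosedImmersion ((ofCocycleSections F₀.U
      (CocycleSections.ofFrameSystem F₀ h1₀ (fun j ↦ η (t j))) hcov_t).toProj f₀) := by
    have e : ofCocycleSections F₀.U (CocycleSections.ofFrameSystem F₀ h1₀ (fun j ↦ η (t j))) hcov_t =
        ofCocycleSections F₀.U (S.restrict Sum.inr) hcov_inr := by
      congr 1
    rw [e]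
    exact Ht
  -- Step 5 (§2): translate to the pulled-back datum of `t`
  have hcov₀ := iSup_basicOpen_comap_coeff_eq_top_of_pullback iX F h1 t h1₀ hcov_t
  refine ⟨m, t, fun x hx ↦ ?_, hcov₀, ?_⟩
  · -- `x ∈ f⁻¹(𝔭)` is `iX y` for a point `y` of the fibre, where some `η(t_j)` generates
    have h𝔭 : f x = (Spec.map (CommRingCat.ofHom (algebraMap A 𝔭.asIdeal.ResidueField)))
        (⊥ : PrimeSpectrum 𝔭.asIdeal.ResidueField) := by
      rw [hx]
      show 𝔭 = PrimeSpectrum.comap (algebraMap A 𝔭.asIdeal.ResidueField) ⊥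
      ext1
      rw [PrimeSpectrum.comap_asIdeal, PrimeSpectrum.asIdeal_bot, ← RingHom.ker_eq_comap_bot,
        Ideal.ker_algebraMap_residueField]
    obtain ⟨y, rfl⟩ := exists_eq_fst_of_isPullback HX x (⊥ : PrimeSpectrum 𝔭.asIdeal.ResidueField) h𝔭
    have hy : y ∈ (⊤ : X₀.Opens) := trivial
    rw [← hcov_t, Opens.mem_iSup] at hy
    obtain ⟨j, hj⟩ := hy
    rw [CocycleSections.ofFrameSystem_coeff, mem_iSup_basicOpen_coeffAt_iff] at hj
    exact ⟨j, mem_basicOpen_coeffAt_of_pullback iX F h1 t h1₀ j y hj⟩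
  · rw [← ofCocycleSections_ofFrameSystem_pullback iX F h1 t h1₀ hcov_t hcov₀]
    exact Ht'

include h1 in
/-- **EGA III 4.7.1 with fibre-only hypotheses ⇒ a PROJECTIVE neighbourhood.** `f : X → Spec A` proper and flat, `A`
noetherian, `E` a line bundle on `X` with a rank-one frame system, `X₀ = X ×_A κ(𝔭)` any cartesian square. If
`Ext¹(𝒪_{X₀}, E|_{X₀}) = 0` and fibre sections `s₀,…,sₙ ∈ Γ(X₀, E|_{X₀})` generate `E|_{X₀}` and embed `X₀ ↪ ℙⁿ_{κ(𝔭)}`, then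
for some `g ∉ 𝔭`, the prime `𝔭₁ = 𝔭A_g` and some `r ∉ 𝔭₁`, the morphism `X_g ×_{A_g} (A_g)_r → Spec (A_g)_r` is PROJECTIVE
(★ `IsProjective`; `exists_globalSections_embedding_fibre` + ★ `exists_isProjective_away_of_frameSystem`).
[cite: EGAIII1, Thm. 4.7.1] [cite: Hartshorne1977, III Thm. 12.11 (p. 290)] -/
theorem exists_isProjective_away_of_fibre_embedding :
    ∃ (g : A), g ∉ 𝔭.asIdeal ∧
      ∃ 𝔭₁ : PrimeSpectrum (Localization.Away g), PrimeSpectrum.comap (algebraMap A (Localization.Away g)) 𝔭₁ = 𝔭 ∧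
      ∃ r : Localization.Away g, r ∉ 𝔭₁.asIdeal ∧ IsProjective
        (pullback.snd (pullback.snd f (Spec.map (CommRingCat.ofHom (algebraMap A (Localization.Away g)))))
          (Spec.map (CommRingCat.ofHom (algebraMap (Localization.Away g) (Localization.Away r))))) := by
  obtain ⟨m, t, hgen, hcov₀, Ht⟩ := exists_globalSections_embedding_fibre f 𝔭 HX F h1 hvan h1₀ s hcov H
  exact exists_isProjective_away_of_frameSystem f 𝔭 HX F h1 t hgen hcov₀ Ht

include h1 in
/-- The projective neighbourhood morphism is in particular PROPER (★ `IsProjective.isProper`).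
[cite: EGAIII1, Thm. 4.7.1] -/
theorem exists_isProjective_and_isProper_away_of_fibre_embedding :
    ∃ (g : A), g ∉ 𝔭.asIdeal ∧
      ∃ 𝔭₁ : PrimeSpectrum (Localization.Away g), PrimeSpectrum.comap (algebraMap A (Localization.Away g)) 𝔭₁ = 𝔭 ∧
      ∃ r : Localization.Away g, r ∉ 𝔭₁.asIdeal ∧
        IsProjective (pullback.snd (pullback.snd f (Spec.map (CommRingCat.ofHom (algebraMap A (Localization.Away g)))))
          (Spec.map (CommRingCat.ofHom (algebraMap (Localization.Away g) (Localization.Away r))))) ∧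
        IsProper (pullback.snd (pullback.snd f (Spec.map (CommRingCat.ofHom (algebraMap A (Localization.Away g)))))
          (Spec.map (CommRingCat.ofHom (algebraMap (Localization.Away g) (Localization.Away r))))) := by
  obtain ⟨g, hg, 𝔭₁, h𝔭₁, r, hr, hP⟩ :=
    exists_isProjective_away_of_fibre_embedding f 𝔭 HX F h1 hvan h1₀ s hcov H
  exact ⟨g, hg, 𝔭₁, h𝔭₁, r, hr, hP, hP.isProper⟩

end FibreEmbedding

end Literature.AlgebraicGeometry.Morphisms
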